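import Summits.AnomalousDissipation.AnomalousDissipation.Theorems.UniformResolution.Negative.FGTBound
import Summits.AnomalousDissipation.AnomalousDissipation.Theorems.UniformResolution.Negative.ResolutionCriterion

/-!
# `MomentParity.UniformResolution` (stmt-AnomalousDissipation-14330), line `Sketch`:
# the enstrophy spectrum of Galerkin-stationary families is TIGHT IN PROBABILITY, uniformly in the level

Support file of the line lead (prover-line-stmt-AnomalousDissipation-14330-0) for the picked line `Sketch`
(`Cruxes/UniformResolution/Lines/Sketch.lean`; card `enstrophy-ui-localized-tail-budget`, its Corollary 1
`TightnessInProbability`). The crux's why-might-fail names two leak scenarios at fixed viscosity: an ensemble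
THERMALISING AT THE CUTOFF (truncated-Euler style, PRL 95 264502) and INTERMITTENT ENSTROPHY (rare bursts of huge
`‖∇u‖` carrying a fixed fraction of the mean). This file removes the first for TYPICAL states: from the landed
weighted `H²` bound (`WeightedH2Bound p`, the Foias–Guillopé–Temam shape; `p = 4` for FGT-stationary laws,
`Negative/FGTBound.lean`) and a uniform bound on the MEAN enstrophy (the energy row), the tail enstrophy
`tailGradNormSq m u = 4π² Σ_{|k|>m} |k|²‖û k‖²` is small IN PROBABILITY uniformly over the family for large `m`:
`μ{tail_m ≥ η} ≤ μ{‖∇u‖² ≥ L} + μ{w ≥ η·4π²(m²+1)/(1+L)^p} ≤ M/L + C(1+L)^p/(η·4π²(m²+1))` (two Markov inequalities and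
the spectral Chebyshev bound `4π²(m²+1)·tail_m ≤ |Au|² = w(1+‖∇u‖²)^p`). So a leak, if any, is carried by events
of vanishing probability and unbounded enstrophy — exactly the uniform-integrability gap isolated by the line's
conjectural stub `stub_loudUI` (cf. `Negative/ResolutionCriterion.lean`, where UNIFORM INTEGRABILITY of the
enstrophy upgrades this to resolution IN THE MEAN).

* `measure_tail_ge_le_of_weightedH2` — the two-Markov estimate for one law (explicit bound).
* `tight_tail_of_weightedH2` — TIGHTNESS IN PROBABILITY of the tail enstrophy over a family with a weighted `H²`
  bound and a common mean-enstrophy bound: `∀ η δ > 0 ∃ m ∀ μ ∈ 𝓕, μ{η ≤ tail_m} ≤ δ`.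
* `tight_tail_of_fgt` — the same for every family of FGT-stationary laws at `ν > 0` (smooth force) with a common
  mean-enstrophy bound (e.g. Galerkin-invariant loud laws in a ball: `ν ∫‖∇u‖² ≤ ‖f‖₂√E`).
-/

noncomputable section

-- `Summit.<Summit>.<Problem>` duplicate namespace is the tree's mandated layout for single-conjunct summits.
set_option linter.dupNamespace false

namespace Summit.AnomalousDissipation.AnomalousDissipation.Theorems.MomentParityUniformResolution

open MeasureTheory Filter Topology
open scoped ENNReal
open Literature.Analysis.FunctionSpaces Literature.Analysis.FluidPDE
open Summit.AnomalousDissipation.AnomalousDissipation.Theses.MomentParity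
open Summit.AnomalousDissipation.AnomalousDissipation.Theorems.QuarticGate.Negative
open Summit.AnomalousDissipation.AnomalousDissipation.Theorems.UniformResolution.Negative
open Summit.AnomalousDissipation.AnomalousDissipation.Theorems.CubicParityLoud.Negative (L2T3)

/-- **Two Markov inequalities.** For one law `μ` on `H` with `∫ |Au|²/(1+‖∇u‖²)^p dμ ≤ C` and `∫ ‖∇u‖² dμ ≤ M`,
every level `L ∈ ℕ`, `L ≠ 0`, cutoff `m` and threshold `η ∉ {0, ∞}`:
`μ{η ≤ tail_m} ≤ M / L + C (1+L)^p / (η · 4π²(m²+1))`, written multiplicatively (no divisions):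
`L · X_m η · μ{η ≤ tail_m} ≤ X_m η · M + L · C (1+L)^p` with `X_m = 4π²(m²+1)`. [folklore] -/
theorem measure_tail_ge_le_of_weightedH2 {μ : Measure (Torus.energySpace (Fin 3))} {p : ℕ} {C M : ℝ≥0∞}
    (hC : ∫⁻ u, eLapNormSq ((u.1 : L2T3) : UnitAddTorus (Fin 3) → EuclideanSpace ℝ (Fin 3)) /
      (1 + Torus.eGradNormSq ((u.1 : L2T3) : UnitAddTorus (Fin 3) → EuclideanSpace ℝ (Fin 3))) ^ p ∂μ ≤ C)
    (hM : ∫⁻ u, Torus.eGradNormSq ((u.1 : L2T3) : UnitAddTorus (Fin 3) → EuclideanSpace ℝ (Fin 3)) ∂μ ≤ M)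
    (L m : ℕ) (η : ℝ≥0∞) :
    (L : ℝ≥0∞) * (ENNReal.ofReal (4 * Real.pi ^ 2 * ((m : ℝ) ^ 2 + 1)) * η) *
        μ {u | η ≤ Torus.tailGradNormSq m ((u.1 : L2T3) : UnitAddTorus (Fin 3) → EuclideanSpace ℝ (Fin 3))} ≤
      ENNReal.ofReal (4 * Real.pi ^ 2 * ((m : ℝ) ^ 2 + 1)) * η * M + (L : ℝ≥0∞) * (C * (1 + (L : ℝ≥0∞)) ^ p) := by
  -- abbreviations
  let eG : Torus.energySpace (Fin 3) → ℝ≥0∞ := fun u =>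
    Torus.eGradNormSq ((u.1 : L2T3) : UnitAddTorus (Fin 3) → EuclideanSpace ℝ (Fin 3))
  let eL : Torus.energySpace (Fin 3) → ℝ≥0∞ := fun u =>
    eLapNormSq ((u.1 : L2T3) : UnitAddTorus (Fin 3) → EuclideanSpace ℝ (Fin 3))
  let tl : Torus.energySpace (Fin 3) → ℝ≥0∞ := fun u =>
    Torus.tailGradNormSq m ((u.1 : L2T3) : UnitAddTorus (Fin 3) → EuclideanSpace ℝ (Fin 3))
  let w : Torus.energySpace (Fin 3) → ℝ≥0∞ := fun u => eL u / (1 + eG u) ^ p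
  have heG : Measurable eG := Torus.measurable_eGradNormSq_coe
  have heL : Measurable eL := measurable_eLapNormSq_coe
  have hw : Measurable w := heL.div ((measurable_const.add heG).pow_const p)
  set X : ℝ≥0∞ := ENNReal.ofReal (4 * Real.pi ^ 2 * ((m : ℝ) ^ 2 + 1)) with hX
  have hX0 : X ≠ 0 := (ENNReal.ofReal_pos.2 (by positivity)).ne'
  have hXtop : X ≠ ⊤ := ENNReal.ofReal_ne_top
  -- the two events
  set B : Set (Torus.energySpace (Fin 3)) := {u | (L : ℝ≥0∞) ≤ eG u} with hB
  set W : Set (Torus.energySpace (Fin 3)) := {u | X * η ≤ w u * (1 + (L : ℝ≥0∞)) ^ p} with hW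
  -- the inclusion {η ≤ tail} ⊆ B ∪ W
  have hincl : {u | η ≤ tl u} ⊆ B ∪ W := by
    intro u hu
    by_cases huB : (L : ℝ≥0∞) ≤ eG u
    · exact Or.inl huB
    · right
      push Not at huB
      have htopu : eG u ≠ ⊤ := huB.ne_top
      have hb0 : (1 + eG u) ^ p ≠ 0 := pow_ne_zero _ (by simp)
      have hbtop : (1 + eG u) ^ p ≠ ⊤ := ENNReal.pow_ne_top (by simpa using htopu)
      have h1 : tl u * X ≤ eL u := tailGradNormSq_mul_le_eLapNormSq m _
      have h2 : eL u = w u * (1 + eG u) ^ p := (ENNReal.div_mul_cancel hb0 hbtop).symm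
      calc X * η ≤ X * tl u := by gcongr; exact hu
        _ = tl u * X := mul_comm _ _
        _ ≤ eL u := h1
        _ = w u * (1 + eG u) ^ p := h2
        _ ≤ w u * (1 + (L : ℝ≥0∞)) ^ p := by gcongr
  -- Markov on B
  have hMB : (L : ℝ≥0∞) * μ B ≤ M := (mul_meas_ge_le_lintegral₀ heG.aemeasurable _).trans hM
  -- Markov on W
  have hMW : (X * η) * μ W ≤ C * (1 + (L : ℝ≥0∞)) ^ p := by
    have hmeas : AEMeasurable (fun u => w u * (1 + (L : ℝ≥0∞)) ^ p) μ := (hw.mul_const _).aemeasurable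
    calc (X * η) * μ W ≤ ∫⁻ u, w u * (1 + (L : ℝ≥0∞)) ^ p ∂μ := mul_meas_ge_le_lintegral₀ hmeas _
      _ = (∫⁻ u, w u ∂μ) * (1 + (L : ℝ≥0∞)) ^ p := lintegral_mul_const _ hw
      _ ≤ C * (1 + (L : ℝ≥0∞)) ^ p := by gcongr
  -- assemble
  calc (L : ℝ≥0∞) * (X * η) * μ {u | η ≤ tl u}
      ≤ (L : ℝ≥0∞) * (X * η) * (μ B + μ W) := by
        gcongr
        exact (measure_mono hincl).trans (measure_union_le B W)
    _ = (X * η) * ((L : ℝ≥0∞) * μ B) + (L : ℝ≥0∞) * ((X * η) * μ W) := by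
        rw [mul_add, mul_comm (L : ℝ≥0∞) (X * η), mul_assoc, mul_assoc, ← mul_assoc (L : ℝ≥0∞) (X * η),
          mul_comm (L : ℝ≥0∞) (X * η), mul_assoc]
    _ ≤ (X * η) * M + (L : ℝ≥0∞) * (C * (1 + (L : ℝ≥0∞)) ^ p) := by gcongr
    _ = X * η * M + (L : ℝ≥0∞) * (C * (1 + (L : ℝ≥0∞)) ^ p) := by rw [mul_assoc]

/-- **TIGHTNESS IN PROBABILITY of the enstrophy spectrum.** A family of laws on `H` with a uniform weighted `H²`
bound (`WeightedH2Bound p 𝓕`) and a common bound `M < ∞` on the mean enstrophy has, for all `η, δ > 0`, one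
cutoff `m` with `μ{η ≤ tail_m} ≤ δ` for every `μ ∈ 𝓕`: TYPICAL states are resolved uniformly over the family;
an `N`-growing leak of the mean enstrophy must live on events of vanishing probability (intermittent enstrophy).
No uniform integrability is assumed. [folklore] -/
theorem tight_tail_of_weightedH2 {𝓕 : Set (Measure (Torus.energySpace (Fin 3)))} {p : ℕ}
    (hH2 : WeightedH2Bound p 𝓕) {M : ℝ≥0∞} (hM : M ≠ ⊤)
    (hmean : ∀ μ ∈ 𝓕, ∫⁻ u, Torus.eGradNormSq ((u.1 : L2T3) : UnitAddTorus (Fin 3) → EuclideanSpace ℝ (Fin 3)) ∂μ ≤ M)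
    (η δ : ℝ≥0∞) (hη : 0 < η) (hδ : 0 < δ) :
    ∃ m : ℕ, ∀ μ ∈ 𝓕,
      μ {u | η ≤ Torus.tailGradNormSq m ((u.1 : L2T3) : UnitAddTorus (Fin 3) → EuclideanSpace ℝ (Fin 3))} ≤ δ := by
  obtain ⟨C, hC, hH2⟩ := hH2
  -- trivial budget
  by_cases hδtop : δ = ⊤
  · exact ⟨0, fun μ _ => hδtop ▸ le_top⟩
  -- shrink the threshold to a finite one
  set η' : ℝ≥0∞ := min η 1 with hη'
  have hη'0 : η' ≠ 0 := (lt_min hη one_pos).ne'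
  have hη'top : η' ≠ ⊤ := ne_top_of_le_ne_top ENNReal.one_ne_top (min_le_right _ _)
  have hη'le : η' ≤ η := min_le_left _ _
  -- half budget
  set δ2 : ℝ≥0∞ := δ / 2 with hδ2
  have hδ20 : δ2 ≠ 0 := (ENNReal.div_pos hδ.ne' ENNReal.ofNat_ne_top).ne'
  have hδ2top : δ2 ≠ ⊤ := ENNReal.div_ne_top hδtop two_ne_zero
  -- the burst level L: M < L δ/2
  obtain ⟨L, hL⟩ := ENNReal.exists_nat_gt (ENNReal.div_ne_top hM hδ20)
  have hL0 : (L : ℝ≥0∞) ≠ 0 := by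
    intro h0; rw [h0] at hL; exact not_lt_zero hL
  have hML : M ≤ (L : ℝ≥0∞) * δ2 := ((ENNReal.div_lt_iff (Or.inl hδ20) (Or.inl hδ2top)).1 hL).le
  -- the cutoff m: C(1+L)^p < m · (η' δ/2)
  have h1L : (1 + (L : ℝ≥0∞)) ^ p ≠ ⊤ := ENNReal.pow_ne_top (by simp)
  have hD : C * (1 + (L : ℝ≥0∞)) ^ p / (η' * δ2) ≠ ⊤ :=
    ENNReal.div_ne_top (ENNReal.mul_ne_top hC h1L) (mul_ne_zero hη'0 hδ20)
  obtain ⟨m, hm⟩ := ENNReal.exists_nat_gt hD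
  have hCm : C * (1 + (L : ℝ≥0∞)) ^ p ≤ (m : ℝ≥0∞) * (η' * δ2) :=
    ((ENNReal.div_lt_iff (Or.inl (mul_ne_zero hη'0 hδ20))
      (Or.inl (ENNReal.mul_ne_top hη'top hδ2top))).1 hm).le
  refine ⟨m, fun μ hμ => ?_⟩
  set X : ℝ≥0∞ := ENNReal.ofReal (4 * Real.pi ^ 2 * ((m : ℝ) ^ 2 + 1)) with hX
  have hX0 : X ≠ 0 := (ENNReal.ofReal_pos.2 (by positivity)).ne'
  have hXtop : X ≠ ⊤ := ENNReal.ofReal_ne_top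
  have hmX : (m : ℝ≥0∞) ≤ X := by
    rw [hX, ← ENNReal.ofReal_natCast]
    apply ENNReal.ofReal_le_ofReal
    have hpi : 3 < Real.pi := Real.pi_gt_three
    have h1 : (m : ℝ) ≤ (m : ℝ) ^ 2 + 1 := by nlinarith [sq_nonneg ((m : ℝ) - 1)]
    have h2 : (1 : ℝ) ≤ 4 * Real.pi ^ 2 := by nlinarith
    have h3 : (0 : ℝ) ≤ (m : ℝ) ^ 2 + 1 := by positivity
    nlinarith
  -- the two-Markov estimate at threshold η'
  have key := measure_tail_ge_le_of_weightedH2 (hH2 μ hμ) (hmean μ hμ) L m η'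
  -- monotonicity in the threshold
  have hmono : μ {u | η ≤ Torus.tailGradNormSq m ((u.1 : L2T3) : UnitAddTorus (Fin 3) → EuclideanSpace ℝ (Fin 3))} ≤
      μ {u | η' ≤ Torus.tailGradNormSq m ((u.1 : L2T3) : UnitAddTorus (Fin 3) → EuclideanSpace ℝ (Fin 3))} :=
    measure_mono fun u hu => hη'le.trans hu
  refine hmono.trans ?_
  set P : ℝ≥0∞ := μ {u | η' ≤ Torus.tailGradNormSq m ((u.1 : L2T3) : UnitAddTorus (Fin 3) → EuclideanSpace ℝ (Fin 3))}
  -- divide the multiplicative estimate by L X η'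
  have hA : (L : ℝ≥0∞) * (X * η') * P ≤ (L : ℝ≥0∞) * (X * η') * (δ2 + δ2) := by
    calc (L : ℝ≥0∞) * (X * η') * P ≤ X * η' * M + (L : ℝ≥0∞) * (C * (1 + (L : ℝ≥0∞)) ^ p) := key
      _ ≤ X * η' * ((L : ℝ≥0∞) * δ2) + (L : ℝ≥0∞) * ((m : ℝ≥0∞) * (η' * δ2)) := by gcongr
      _ ≤ X * η' * ((L : ℝ≥0∞) * δ2) + (L : ℝ≥0∞) * (X * (η' * δ2)) := by gcongr
      _ = (L : ℝ≥0∞) * (X * η') * (δ2 + δ2) := by ring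
  have hLXη0 : (L : ℝ≥0∞) * (X * η') ≠ 0 := mul_ne_zero hL0 (mul_ne_zero hX0 hη'0)
  have hLXηtop : (L : ℝ≥0∞) * (X * η') ≠ ⊤ :=
    ENNReal.mul_ne_top (ENNReal.natCast_ne_top L) (ENNReal.mul_ne_top hXtop hη'top)
  have hP : P ≤ δ2 + δ2 := (ENNReal.mul_le_mul_iff_right hLXη0 hLXηtop).1 hA
  calc P ≤ δ2 + δ2 := hP
    _ = δ := ENNReal.add_halves δ

/-- **Tightness in probability for FGT-stationary families.** At `ν > 0` with a smooth force, every family of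
FGT-stationary laws (e.g. Galerkin-INVARIANT laws carried by level-`N` fields in balls, for any levels) with a
common bound `M < ∞` on the mean enstrophy has a tight-in-probability enstrophy spectrum, uniformly over the
family: `∀ η δ > 0 ∃ m ∀ μ ∈ 𝓕, μ{η ≤ tail_m} ≤ δ`. For Galerkin-invariant loud laws in a ball the mean bound is the
energy row `ν ∫‖∇u‖² ≤ ‖f‖₂ √E`; hence cutoff thermalisation of TYPICAL states is impossible at positive viscosity
and an `N`-uniform leak must be intermittent. [folklore] -/
theorem tight_tail_of_fgt {f : UnitAddTorus (Fin 3) → EuclideanSpace ℝ (Fin 3)} (hf : Torus.IsSmooth f)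
    {ν : ℝ} (hν : 0 < ν) {𝓕 : Set (Measure (Torus.energySpace (Fin 3)))}
    (h𝓕 : ∀ μ ∈ 𝓕, ∃ N, IsFGTStationary ν f N μ) {M : ℝ≥0∞} (hM : M ≠ ⊤)
    (hmean : ∀ μ ∈ 𝓕, ∫⁻ u, Torus.eGradNormSq ((u.1 : L2T3) : UnitAddTorus (Fin 3) → EuclideanSpace ℝ (Fin 3)) ∂μ ≤ M)
    (η δ : ℝ≥0∞) (hη : 0 < η) (hδ : 0 < δ) :
    ∃ m : ℕ, ∀ μ ∈ 𝓕,
      μ {u | η ≤ Torus.tailGradNormSq m ((u.1 : L2T3) : UnitAddTorus (Fin 3) → EuclideanSpace ℝ (Fin 3))} ≤ δ :=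
  tight_tail_of_weightedH2 (weightedH2Bound_four_of_fgt hν hf h𝓕) hM hmean η δ hη hδ

/-- **Registered form (sub-goal `tight_in_probability` of stmt-AnomalousDissipation-14330).** Tightness in
probability of the enstrophy spectrum, uniformly over any family of FGT-stationary laws at `ν > 0` with a common
mean-enstrophy bound (card `enstrophy-ui-localized-tail-budget`, Corollary 1; the cutoff-thermalisation scenario
of the crux's why-might-fail is excluded for typical states). [folklore] -/
theorem tight_in_probability : ∀ (f : UnitAddTorus (Fin 3) → EuclideanSpace ℝ (Fin 3)), Literature.Analysis.FunctionSpaces.Torus.IsSmooth f → ∀ (ν : ℝ), 0 < ν → ∀ (𝓕 : Set (MeasureTheory.Measure (Literature.Analysis.FunctionSpaces.Torus.energySpace (Fin 3)))), (∀ μ ∈ 𝓕, ∃ N : ℕ, Summit.AnomalousDissipation.AnomalousDissipation.Theorems.UniformResolution.Negative.IsFGTStationary ν f N μ) → ∀ (M : ENNReal), M ≠ ⊤ → (∀ μ ∈ 𝓕, MeasureTheory.lintegral μ (fun u => Literature.Analysis.FunctionSpaces.Torus.eGradNormSq (u.1 : UnitAddTorus (Fin 3) → EuclideanSpace ℝ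 (Fin 3))) ≤ M) → ∀ (η δ : ENNReal), 0 < η → 0 < δ → ∃ m : ℕ, ∀ μ ∈ 𝓕, μ {u | η ≤ Literature.Analysis.FluidPDE.Torus.tailGradNormSq m (u.1 : UnitAddTorus (Fin 3) → EuclideanSpace ℝ (Fin 3))} ≤ δ :=
  fun _ hf _ hν _ h𝓕 _ hM hmean η δ hη hδ => tight_tail_of_fgt hf hν h𝓕 hM hmean η δ hη hδ

end Summit.AnomalousDissipation.AnomalousDissipation.Theorems.MomentParityUniformResolution

end
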